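import Mathlib
import HarnessLib
import Summits.NavierStokesRegularity.NavierStokesRegularity.Theorems.PoloidalWindowDoorLrcModEntireTwistingTHBranchBounds
import Summits.NavierStokesRegularity.NavierStokesRegularity.Theorems.PoloidalWindowDoorLrcModEntireTwistingTHOscRoadSigned

/-!
# Item `LrcModEntire` (stmt-NavierStokesRegularity-20428), skeleton twist_split v6 — the CLASS road to `stub_twistingTHGerm` BY NAME from the
# typed (BRANCH) hypothesis: global (TH) slope + slope dictionary + `C²` plane-extremizer branches

Cell ns-regularity-ideate, seat ns-k2-port-2 g4 (kernel-port lineage; `--supports stmt-NavierStokesRegularity-20428 --as helper`; final assembly (F5e) of the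
LEAD ns-poloidal-K2-p3 g13's successor brick «`planeOscObject_of_branches`», memo OSC-LIOUVILLE-g13 v1.5 §5septies (BRANCH)).  Chain:
`…TwistingTHBranchLaw` (signed law at a point) → `…BranchValues` (branch-value calculus) → `…BranchObject`/`…BranchBounds` (regularity, signed law,
Type-I dictionary of `U = (1−μ)(Θ⁺ − Θ⁻)`, `S = Θ⁺ + Θ⁻`) → HERE:

* `weightOsc_le_of_extremal` — the PLANE MAJORANT on one slice: if the plane `{y₂ = c}` is proportional-shear with SOME slope `μ′` and also with
  slope `μ₀`, and `Θ⁻ ≤ v₂ ≤ Θ⁺` on the plane, then `|(1−μ′)(v₂(y) − v₂(y′))| ≤ |(1−μ₀)(Θ⁺ − Θ⁻)|` for `y, y′` on the plane (non-flat plane ⇒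
  `μ′ = μ₀`; flat plane ⇒ `v₂` is constant on the plane, by the mean value theorem along the horizontal segment);
* `signedPlaneOscObject_of_branches` — (TH-global) + (SD) + (BR) for a poloidal class profile with hot-spot size `N` ⇒ the SIGNED (t,z)-object of
  `…TwistingTHOscRoadSigned.eq_zero_of_signedPlaneOscObject_poly` (polynomial size currency, exponent `2k`);
* `twistingTHGerm_of_branches` — **the registered signature of `stub_twistingTHGerm` VERBATIM** from «every normalised windowed poloidal class profile
  admits (TH-global) + (SD) + (BR)» (`twistingTHGerm_of_signedPlaneOscObject_poly`).
So the (TH) column of `LrcModEntire` is reduced, in the kernel and by name, to the typed kinematic statement (BR) (smooth, globally defined branches of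
plane maximisers/minimisers of `v₂` with scale-free slope `‖∂_z x±‖ ≲ P`) plus the slope dictionary (SD) (⇐ uniform non-flatness, one-point quotient
rule; `…SlopeDictionary` covers `μ, μ_z`) — no parabolic-proximity hypothesis, no branch-velocity hypothesis, no sign condition on `1−μ`.

WHAT THIS IS NOT: not a claim about Navier–Stokes regularity and not a proof of the stub — a reduction BY NAME; (BR)+(SD) is the wall, typed, not proved
(bears_on LADDER-NS N0, item 20428 / crux 19708; both OPEN).
-/

noncomputable section

-- the summit and its single sub-problem share the name (CONVENTIONS §1), as in every Theorems file
set_option linter.dupNamespace false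

namespace Summit.NavierStokesRegularity.NavierStokesRegularity.Theorems.PoloidalWindowDoorLrcModEntireTwistingTHBranchRoad

open Set Function Filter Topology
open scoped RealInnerProductSpace InnerProductSpace Laplacian
open Literature.Analysis Literature.Analysis.FluidPDE
open Summit.NavierStokesRegularity.NavierStokesRegularity.Theorems.PoloidalWindowDoorPoloidalWindowRigidityWindow
open Summit.NavierStokesRegularity.NavierStokesRegularity.Theorems.PoloidalWindowDoorLrcModEntireTwistingTHPlaneOscillation
open Summit.NavierStokesRegularity.NavierStokesRegularity.Theorems.PoloidalWindowDoorLrcModEntireTwistingTHBranchLaw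
open Summit.NavierStokesRegularity.NavierStokesRegularity.Theorems.PoloidalWindowDoorLrcModEntireTwistingTHBranchValues
open Summit.NavierStokesRegularity.NavierStokesRegularity.Theorems.PoloidalWindowDoorLrcModEntireTwistingTHBranchObject
open Summit.NavierStokesRegularity.NavierStokesRegularity.Theorems.PoloidalWindowDoorLrcModEntireTwistingTHBranchBounds
open Summit.NavierStokesRegularity.NavierStokesRegularity.Theorems.PoloidalWindowDoorLrcModEntireTwistingTHOscRoadSigned

/-! ### The plane majorant on one slice -/

/-- Coordinate `2` of a directional derivative of a vector field is the directional derivative of its coordinate `2`. -/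
theorem fderiv_vert_apply {V : EuclideanSpace ℝ (Fin 3) → EuclideanSpace ℝ (Fin 3)} (hV : Differentiable ℝ V)
    (y u : EuclideanSpace ℝ (Fin 3)) : fderiv ℝ (fun w => V w 2) y u = (fderiv ℝ V y u) 2 := by
  have h := ((EuclideanSpace.proj (𝕜 := ℝ) (2 : Fin 3)).hasFDerivAt.comp y (hV y).hasFDerivAt).fderiv
  rw [show (fun w => V w 2) = (EuclideanSpace.proj (𝕜 := ℝ) (2 : Fin 3)) ∘ V from rfl, h]
  simp

/-- **THE PLANE MAJORANT (one slice).**  Let `V` be differentiable; let the plane `{y₂ = c}` be proportional-shear with slope `μ′` AND with slope `μ₀`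
(`∂₂V_b = μ·∂_bV₂` on the plane, `b = 0, 1`); let `Θ⁻ ≤ V₂ ≤ Θ⁺` on the plane.  Then for `y, y′` on the plane,
`|(1−μ′)(V₂(y) − V₂(y′))| ≤ |(1−μ₀)(Θ⁺ − Θ⁻)|`.  (Non-flat plane: `μ′ = μ₀`.  Flat plane: `V₂` is constant on it.) -/
theorem weightOsc_le_of_extremal {V : EuclideanSpace ℝ (Fin 3) → EuclideanSpace ℝ (Fin 3)} (hV : Differentiable ℝ V) {c μ' μ₀ Θp Θm : ℝ}
    (hμ' : ∀ y : EuclideanSpace ℝ (Fin 3), y 2 = c → ∀ b : Fin 3, b ≠ 2 →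
      fderiv ℝ V y (EuclideanSpace.single 2 1) b = μ' * fderiv ℝ V y (EuclideanSpace.single b 1) 2)
    (hμ₀ : ∀ y : EuclideanSpace ℝ (Fin 3), y 2 = c → ∀ b : Fin 3, b ≠ 2 →
      fderiv ℝ V y (EuclideanSpace.single 2 1) b = μ₀ * fderiv ℝ V y (EuclideanSpace.single b 1) 2)
    (hmax : ∀ y : EuclideanSpace ℝ (Fin 3), y 2 = c → V y 2 ≤ Θp) (hmin : ∀ y : EuclideanSpace ℝ (Fin 3), y 2 = c → Θm ≤ V y 2)
    {y y' : EuclideanSpace ℝ (Fin 3)} (hy : y 2 = c) (hy' : y' 2 = c) :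
    |(1 - μ') * (V y 2 - V y' 2)| ≤ |(1 - μ₀) * (Θp - Θm)| := by
  have hG : Differentiable ℝ (fun w => V w 2) := fun w =>
    (EuclideanSpace.proj (𝕜 := ℝ) (2 : Fin 3)).differentiableAt.comp w (hV w)
  by_cases hflat : ∀ y₀ : EuclideanSpace ℝ (Fin 3), y₀ 2 = c → ∀ b : Fin 3, b ≠ 2 →
      fderiv ℝ (fun w => V w 2) y₀ (EuclideanSpace.single b 1) = 0
  · -- flat plane: `V₂` is constant along the horizontal segment from `y′` to `y`
    set g : ℝ → ℝ := fun σ => V (y' + σ • (y - y')) 2 with hg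
    have hseg2 : ∀ σ : ℝ, (y' + σ • (y - y')) 2 = c := by
      intro σ; simp [hy, hy']
    have hgd : ∀ σ, HasDerivAt g 0 σ := by
      intro σ
      have h := hasDerivAt_comp_line hG y' (y - y') σ
      rw [fderiv_apply_of_horiz_eq_zero (hflat _ (hseg2 σ) 0 (by decide)) (hflat _ (hseg2 σ) 1 (by decide)),
        show (y - y') 2 = 0 by simp [hy, hy'], zero_mul] at h
      exact h
    have hconst := is_const_of_deriv_eq_zero (fun σ => (hgd σ).differentiableAt) (fun σ => (hgd σ).deriv) 1 0
    have e1 : g 1 = V y 2 := by simp [hg]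
    have e0 : g 0 = V y' 2 := by simp [hg]
    rw [← e1, ← e0, hconst, sub_self, mul_zero, abs_zero]
    exact abs_nonneg _
  · -- non-flat plane: the two slopes agree
    push Not at hflat
    obtain ⟨y₀, hy₀, b, hb, hne⟩ := hflat
    rw [fderiv_vert_apply hV] at hne
    have h1 := hμ' y₀ hy₀ b hb
    have h2 := hμ₀ y₀ hy₀ b hb
    have hμeq : μ' = μ₀ := mul_right_cancel₀ hne (h1.symm.trans h2)
    rw [hμeq, abs_mul, abs_mul]
    refine mul_le_mul_of_nonneg_left ?_ (abs_nonneg _)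
    have hD : Θm ≤ Θp := (hmin y hy).trans (hmax y hy)
    rw [abs_of_nonneg (sub_nonneg.2 hD)]
    exact abs_sub_le_iff.2 ⟨by linarith [hmax y hy, hmin y' hy'], by linarith [hmax y' hy', hmin y hy]⟩

/-! ### The signed object from (TH-global) + (SD) + (BR) -/

section Class

variable {C : ℝ} {v : ℝ → EuclideanSpace ℝ (Fin 3) → EuclideanSpace ℝ (Fin 3)}

/-- **(BRANCH) ⇒ THE SIGNED (t,z)-OBJECT.**  A poloidal class profile with hot-spot size `N`, a global (TH) slope `μ` (`C³` on the open slab) with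
the slope dictionary (SD), and `C²` branches of global plane maximisers / minimisers of `v₂` with scale-free branch slope (BR) admit the signed
object of `…TwistingTHOscRoadSigned.eq_zero_of_signedPlaneOscObject_poly` (with `U = (1−μ)(Θ⁺−Θ⁻)`, `S = Θ⁺+Θ⁻`, exponent `2k`). -/
theorem signedPlaneOscObject_of_branches
    (hrate : HasTypeITimeDecay C v) (hcont : ContinuousOn (uncurry v) (Iio (0 : ℝ) ×ˢ univ))
    (hmild : ∀ s t : ℝ, s < t → t < 0 → ∀ x,
      v t x = UnboundedOperators.heatExtension (v s) (t - s) x - oseenDuhamel 1 s v v t x)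
    (hdiv : ∀ t < 0, VectorCalculus.IsDivFree (v t))
    (hpol : ∀ s < 0, ∀ y, ⟪curl (v s) y, EuclideanSpace.single 2 1⟫_ℝ = 0)
    {N : ℝ} (hN : ∀ t < 0, ∀ x : EuclideanSpace ℝ (Fin 3), Real.sqrt (-t) * |v t x 2| ≤ N)
    {μ : ℝ → ℝ → ℝ}
    (hTH : ∀ s < 0, ∀ y : EuclideanSpace ℝ (Fin 3), ∀ b : Fin 3, b ≠ 2 →
      fderiv ℝ (v s) y (EuclideanSpace.single 2 1) b = μ s (y 2) * fderiv ℝ (v s) y (EuclideanSpace.single b 1) 2)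
    (hμC : ContDiffOn ℝ 3 (uncurry μ) (Iio (0 : ℝ) ×ˢ univ))
    {Kμ : ℝ} {k : ℕ}
    (hμb : ∀ t < 0, ∀ z, |μ t z| ≤ Kμ * (1 + z ^ 2 / (-t)) ^ k)
    (hμt : ∀ t < 0, ∀ z, (-t) * |deriv (fun s => μ s z) t| ≤ Kμ * (1 + z ^ 2 / (-t)) ^ k)
    (hμz : ∀ t < 0, ∀ z, Real.sqrt (-t) * |deriv (μ t) z| ≤ Kμ * (1 + z ^ 2 / (-t)) ^ k)
    (hμzz : ∀ t < 0, ∀ z, (-t) * |deriv (deriv (μ t)) z| ≤ Kμ * (1 + z ^ 2 / (-t)) ^ k)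
    {xp xm : ℝ → ℝ → EuclideanSpace ℝ (Fin 3)}
    (hxp2 : ∀ t < 0, ∀ z, xp t z 2 = z) (hxm2 : ∀ t < 0, ∀ z, xm t z 2 = z)
    (hxpC : ContDiffOn ℝ 2 (uncurry xp) (Iio (0 : ℝ) ×ˢ univ)) (hxmC : ContDiffOn ℝ 2 (uncurry xm) (Iio (0 : ℝ) ×ˢ univ))
    (hmax : ∀ t < 0, ∀ z, ∀ y : EuclideanSpace ℝ (Fin 3), y 2 = z → v t y 2 ≤ v t (xp t z) 2)
    (hmin : ∀ t < 0, ∀ z, ∀ y : EuclideanSpace ℝ (Fin 3), y 2 = z → v t (xm t z) 2 ≤ v t y 2)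
    {B₁ : ℝ}
    (hxpz : ∀ t < 0, ∀ z, ‖deriv (xp t) z‖ ≤ B₁ * (1 + z ^ 2 / (-t)) ^ k)
    (hxmz : ∀ t < 0, ∀ z, ‖deriv (xm t) z‖ ≤ B₁ * (1 + z ^ 2 / (-t)) ^ k) :
    ∃ (U S : ℝ → ℝ → ℝ) (Ud : ℝ → ℝ → (ℝ × ℝ →L[ℝ] ℝ)) (c A K : ℝ) (k : ℕ),
      (∀ t < 0, ∀ z, HasFDerivAt (Function.uncurry U) (Ud t z) (t, z)) ∧
      (∀ t < 0, Continuous fun z => Ud t z (1, 0)) ∧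
      (∀ t < 0, ContDiff ℝ 2 (U t)) ∧ (∀ t < 0, ContDiff ℝ 1 (S t)) ∧
      (∀ t < 0, ∀ z, U t z * (Ud t z (1, 0) + (1 / 2 : ℝ) * deriv (fun z => S t z * U t z) z - deriv (deriv (U t)) z) ≤ 0) ∧
      (∀ t < 0, ∀ z, Real.sqrt (-t) * |U t z| ≤ c * (1 + z ^ 2 / (-t)) ^ k) ∧
      (∀ t < 0, ∀ z, Real.sqrt (-t) * |S t z| ≤ A) ∧
      (∀ t < 0, ∀ z, Real.sqrt (-t) * (-t) * |Ud t z (1, 0)| ≤ K * (1 + z ^ 2 / (-t)) ^ k) ∧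
      (∀ t < 0, ∀ z, (-t) * |deriv (U t) z| ≤ K * (1 + z ^ 2 / (-t)) ^ k) ∧
      (∀ t < 0, ∀ z, Real.sqrt (-t) * (-t) * |deriv (deriv (U t)) z| ≤ K * (1 + z ^ 2 / (-t)) ^ k) ∧
      (∀ t < 0, ∀ z, (-t) * |deriv (S t) z| ≤ K * (1 + z ^ 2 / (-t)) ^ k) ∧
      (∀ t : ℝ, t < 0 → ∀ z μ : ℝ,
        (∀ y : EuclideanSpace ℝ (Fin 3), y 2 = z → ∀ b : Fin 3, b ≠ 2 →
          fderiv ℝ (v t) y (EuclideanSpace.single 2 1) b = μ * fderiv ℝ (v t) y (EuclideanSpace.single b 1) 2) →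
        ∀ y y' : EuclideanSpace ℝ (Fin 3), y 2 = z → y' 2 = z → |(1 - μ) * (v t y 2 - v t y' 2)| ≤ |U t z|) := by
  -- the object
  set U : ℝ → ℝ → ℝ := fun s h => (1 - μ s h) * (v s (xp s h) 2 - v s (xm s h) 2) with hU
  set S : ℝ → ℝ → ℝ := fun s h => v s (xp s h) 2 + v s (xm s h) 2 with hS
  have hUC := contDiffOn_U hrate hcont hmild hdiv hμC hxpC hxmC hU
  have hSC := contDiffOn_S hrate hcont hmild hdiv hxpC hxmC hS
  obtain ⟨K₁, hK₁, hb₁⟩ := Ut_bound hrate hcont hmild hdiv hN hμC hμb hμt hxp2 hxm2 hxpC hxmC hmax hmin hU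
  obtain ⟨K₂, hK₂, hb₂⟩ := Uz_bound hrate hcont hmild hdiv hN hμC hμb hμz hxp2 hxm2 hxpC hxmC hmax hmin hU
  obtain ⟨K₃, hK₃, hb₃⟩ := Uzz_bound hrate hcont hmild hdiv hN hμC hμb hμz hμzz hxp2 hxm2 hxpC hxmC hmax hmin hxpz hxmz hU
  obtain ⟨K₄, hK₄, hb₄⟩ := Sz_bound hrate hcont hmild hdiv hxp2 hxm2 hxpC hxmC hmax hmin hS
  have hslab : IsOpen (Iio (0 : ℝ) ×ˢ (univ : Set ℝ)) := isOpen_Iio.prod isOpen_univ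
  have hP0 : ∀ t < 0, ∀ z : ℝ, (0 : ℝ) ≤ (1 + z ^ 2 / (-t)) ^ (2 * k) := fun t ht z =>
    pow_nonneg (le_trans zero_le_one (le_add_of_nonneg_right (div_nonneg (sq_nonneg z) (neg_pos.2 ht).le))) _
  refine ⟨U, S, fun t z => fderiv ℝ (uncurry U) (t, z), 2 * N * (1 + Kμ), 2 * N, K₁ + K₂ + K₃ + K₄, 2 * k,
    ?_, ?_, ?_, ?_, ?_, ?_, ?_, ?_, ?_, ?_, ?_, ?_⟩
  · exact fun t ht z => ((hUC.differentiableOn (by norm_num)).differentiableAt (slab_mem_nhds ht z)).hasFDerivAt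
  · intro t ht
    have hc : ContinuousOn (fderiv ℝ (uncurry U)) (Iio (0 : ℝ) ×ˢ univ) := hUC.continuousOn_fderiv_of_isOpen hslab (by norm_num)
    have hι : Continuous fun z : ℝ => ((t, z) : ℝ × ℝ) := by fun_prop
    exact (hc.comp_continuous hι fun z => mk_mem_prod ht (mem_univ z)).clm_apply continuous_const
  · exact fun t ht => contDiff_heightSlice hUC ht
  · exact fun t ht => (contDiff_heightSlice hSC ht).of_le (by norm_cast)
  · exact signedLaw_U hrate hcont hmild hdiv hpol hTH hμC hxp2 hxm2 hxpC hxmC hmax hmin hU hS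
  · exact abs_U_le hN hμb hxm2 hmax hU
  · exact abs_S_le hN hS
  · intro t ht z
    exact (hb₁ t ht z).trans (mul_le_mul_of_nonneg_right (by linarith) (hP0 t ht z))
  · intro t ht z
    exact (hb₂ t ht z).trans (mul_le_mul_of_nonneg_right (by linarith) (hP0 t ht z))
  · intro t ht z
    exact (hb₃ t ht z).trans (mul_le_mul_of_nonneg_right (by linarith) (hP0 t ht z))
  · intro t ht z
    exact (hb₄ t ht z).trans (mul_le_mul_of_nonneg_right (by linarith) (hP0 t ht z))
  · -- the plane majorant
    intro t ht z μ' hμ' y y' hy hy'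
    have hVd : Differentiable ℝ (v t) :=
      ((isTypeIAncientMild_of_class hrate hcont hmild hdiv).contDiff_slice ht).differentiable (by simp)
    have h := weightOsc_le_of_extremal hVd (c := z) (μ₀ := μ t z) (Θp := v t (xp t z) 2) (Θm := v t (xm t z) 2) hμ'
      (fun y₀ hy₀ b hb => by rw [← hy₀]; exact hTH t ht y₀ b hb) (fun y₀ hy₀ => hmax t ht z y₀ hy₀) (fun y₀ hy₀ => hmin t ht z y₀ hy₀) hy hy'
    simpa [hU] using h

/-- **THE CLASS ROAD TO `stub_twistingTHGerm` BY NAME FROM (BRANCH).**  If every poloidal class profile normalised at the hot spot and carrying a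
(TH) window admits a global (TH) slope with the slope dictionary (SD) and `C²` branches of global plane maximisers / minimisers of `v₂` with
scale-free branch slope (BR), then the registered signature of `stub_twistingTHGerm` (skeleton `Cruxes/LrcModEntire/Lines/twist_split.lean` v6) holds. -/
theorem twistingTHGerm_of_branches
    (hBR : ∀ (C : ℝ) (v : ℝ → EuclideanSpace ℝ (Fin 3) → EuclideanSpace ℝ (Fin 3)),
      Literature.Analysis.FluidPDE.HasTypeITimeDecay C v →
      ContinuousOn (Function.uncurry v) (Set.Iio (0 : ℝ) ×ˢ Set.univ) →
      (∀ s t : ℝ, s < t → t < 0 → ∀ x, v t x =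
        Literature.Analysis.UnboundedOperators.heatExtension (v s) (t - s) x -
          Literature.Analysis.FluidPDE.oseenDuhamel 1 s v v t x) →
      (∀ t < 0, Literature.Analysis.FluidPDE.VectorCalculus.IsDivFree (v t)) →
      (∀ s < 0, ∀ y, ⟪Literature.Analysis.FluidPDE.curl (v s) y, EuclideanSpace.single 2 1⟫_ℝ = 0) →
      v (-1) 0 2 ≠ 0 → (∀ t < 0, ∀ x, Real.sqrt (-t) * |v t x 2| ≤ |v (-1) 0 2|) →
      ∀ W : Set (ℝ × EuclideanSpace ℝ (Fin 3)), IsOpen W → W.Nonempty → W ⊆ Set.Iio (0 : ℝ) ×ˢ Set.univ →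
        (∃ m : ℝ → ℝ → ℝ, ∀ z ∈ W, ∀ b : Fin 3, b ≠ 2 →
            fderiv ℝ (v z.1) z.2 (EuclideanSpace.single 2 1) b =
              m z.1 (z.2 2) * fderiv ℝ (v z.1) z.2 (EuclideanSpace.single b 1) 2) →
        ∃ (μ : ℝ → ℝ → ℝ) (Kμ : ℝ) (k : ℕ) (xp xm : ℝ → ℝ → EuclideanSpace ℝ (Fin 3)) (B₁ : ℝ),
          (∀ s < 0, ∀ y : EuclideanSpace ℝ (Fin 3), ∀ b : Fin 3, b ≠ 2 →
            fderiv ℝ (v s) y (EuclideanSpace.single 2 1) b = μ s (y 2) * fderiv ℝ (v s) y (EuclideanSpace.single b 1) 2) ∧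
          ContDiffOn ℝ 3 (Function.uncurry μ) (Set.Iio (0 : ℝ) ×ˢ Set.univ) ∧
          (∀ t < 0, ∀ z, |μ t z| ≤ Kμ * (1 + z ^ 2 / (-t)) ^ k) ∧
          (∀ t < 0, ∀ z, (-t) * |deriv (fun s => μ s z) t| ≤ Kμ * (1 + z ^ 2 / (-t)) ^ k) ∧
          (∀ t < 0, ∀ z, Real.sqrt (-t) * |deriv (μ t) z| ≤ Kμ * (1 + z ^ 2 / (-t)) ^ k) ∧
          (∀ t < 0, ∀ z, (-t) * |deriv (deriv (μ t)) z| ≤ Kμ * (1 + z ^ 2 / (-t)) ^ k) ∧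
          (∀ t < 0, ∀ z, xp t z 2 = z) ∧ (∀ t < 0, ∀ z, xm t z 2 = z) ∧
          ContDiffOn ℝ 2 (Function.uncurry xp) (Set.Iio (0 : ℝ) ×ˢ Set.univ) ∧
          ContDiffOn ℝ 2 (Function.uncurry xm) (Set.Iio (0 : ℝ) ×ˢ Set.univ) ∧
          (∀ t < 0, ∀ z, ∀ y : EuclideanSpace ℝ (Fin 3), y 2 = z → v t y 2 ≤ v t (xp t z) 2) ∧
          (∀ t < 0, ∀ z, ∀ y : EuclideanSpace ℝ (Fin 3), y 2 = z → v t (xm t z) 2 ≤ v t y 2) ∧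
          (∀ t < 0, ∀ z, ‖deriv (xp t) z‖ ≤ B₁ * (1 + z ^ 2 / (-t)) ^ k) ∧
          (∀ t < 0, ∀ z, ‖deriv (xm t) z‖ ≤ B₁ * (1 + z ^ 2 / (-t)) ^ k)) :
    ∀ (C : ℝ) (v : ℝ → EuclideanSpace ℝ (Fin 3) → EuclideanSpace ℝ (Fin 3)),
      Literature.Analysis.FluidPDE.HasTypeITimeDecay C v →
      ContinuousOn (Function.uncurry v) (Set.Iio (0 : ℝ) ×ˢ Set.univ) →
      (∀ s t : ℝ, s < t → t < 0 → ∀ x, v t x =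
        Literature.Analysis.UnboundedOperators.heatExtension (v s) (t - s) x -
          Literature.Analysis.FluidPDE.oseenDuhamel 1 s v v t x) →
      (∀ t < 0, Literature.Analysis.FluidPDE.VectorCalculus.IsDivFree (v t)) →
      (∀ s < 0, ∀ y, ⟪Literature.Analysis.FluidPDE.curl (v s) y, EuclideanSpace.single 2 1⟫_ℝ = 0) →
      v (-1) 0 2 ≠ 0 → (∀ t < 0, ∀ x, Real.sqrt (-t) * |v t x 2| ≤ |v (-1) 0 2|) →
      (∀ h : EuclideanSpace ℝ (Fin 3), fderiv ℝ (v (-1)) 0 h 2 = 0) →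
      (deriv (fun s => v s 0 2) (-1) = v (-1) 0 2 / 2 ∧ v (-1) 0 2 * (Δ (fun y => v (-1) y 2)) 0 ≤ 0) →
      ∀ W : Set (ℝ × EuclideanSpace ℝ (Fin 3)), IsOpen W → W.Nonempty → W ⊆ Set.Iio (0 : ℝ) ×ˢ Set.univ →
        (∀ z ∈ W, (Literature.Analysis.FluidPDE.curl (v z.1) z.2 ≠ 0 ∧
            (fderiv ℝ (v z.1) z.2 (EuclideanSpace.single 0 1) 2 ≠ 0 ∨ fderiv ℝ (v z.1) z.2 (EuclideanSpace.single 1 1) 2 ≠ 0) ∧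
            (fderiv ℝ (v z.1) z.2 (EuclideanSpace.single 2 1) 0 ≠ 0 ∨ fderiv ℝ (v z.1) z.2 (EuclideanSpace.single 2 1) 1 ≠ 0))) →
        (∀ m : ℝ → ℝ, ∀ W₁ : Set (ℝ × EuclideanSpace ℝ (Fin 3)), W₁ ⊆ W → IsOpen W₁ → W₁.Nonempty →
            ∃ z ∈ W₁, ∃ b : Fin 3, b ≠ 2 ∧
              fderiv ℝ (v z.1) z.2 (EuclideanSpace.single 2 1) b ≠
                m z.1 * fderiv ℝ (v z.1) z.2 (EuclideanSpace.single b 1) 2) →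
        (∀ z ∈ W, (fderiv ℝ (fun x => fderiv ℝ (v z.1) x (EuclideanSpace.single 2 1) 2) z.2 (EuclideanSpace.single 0 1) *
                fderiv ℝ (v z.1) z.2 (EuclideanSpace.single 1 1) 2 -
              fderiv ℝ (fun x => fderiv ℝ (v z.1) x (EuclideanSpace.single 2 1) 2) z.2 (EuclideanSpace.single 1 1) *
                fderiv ℝ (v z.1) z.2 (EuclideanSpace.single 0 1) 2 ≠ 0)) →
        (∃ m : ℝ → ℝ → ℝ, ∀ z ∈ W, ∀ b : Fin 3, b ≠ 2 →
            fderiv ℝ (v z.1) z.2 (EuclideanSpace.single 2 1) b =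
              m z.1 (z.2 2) * fderiv ℝ (v z.1) z.2 (EuclideanSpace.single b 1) 2) →
        ∃ s : ℝ, s < 0 ∧ ∃ U : Set (EuclideanSpace ℝ (Fin 3)), IsOpen U ∧ U.Nonempty ∧
          ((∃ e : EuclideanSpace ℝ (Fin 3), e ≠ 0 ∧
              ∀ y ∈ U, fderiv ℝ (Literature.Analysis.FluidPDE.curl (v s)) y e = 0) ∨
           (∃ c : EuclideanSpace ℝ (Fin 3), ∀ y ∈ U,
              Literature.Analysis.FluidPDE.rotGen (Literature.Analysis.FluidPDE.curl (v s) y) =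
                fderiv ℝ (Literature.Analysis.FluidPDE.curl (v s)) y (Literature.Analysis.FluidPDE.rotGen (y - c))) ∨
           (∃ w : EuclideanSpace ℝ (Fin 3) → EuclideanSpace ℝ (Fin 3), AnalyticOnNhd ℝ w Set.univ ∧
              ¬ BddAbove (Set.range fun y => ‖w y‖) ∧ ∀ y ∈ U, v s y = w y)) :=
  twistingTHGerm_of_signedPlaneOscObject_poly fun C v hrate hcont hmild hdiv hpol hne hhot W hW hWne hWs hTHW => by
    obtain ⟨μ, Kμ, k, xp, xm, B₁, hTH, hμC, hμb, hμt, hμz, hμzz, hxp2, hxm2, hxpC, hxmC, hmax, hmin, hxpz, hxmz⟩ :=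
      hBR C v hrate hcont hmild hdiv hpol hne hhot W hW hWne hWs hTHW
    exact signedPlaneOscObject_of_branches hrate hcont hmild hdiv hpol hhot hTH hμC hμb hμt hμz hμzz hxp2 hxm2 hxpC hxmC hmax hmin hxpz hxmz

end Class

end Summit.NavierStokesRegularity.NavierStokesRegularity.Theorems.PoloidalWindowDoorLrcModEntireTwistingTHBranchRoad
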